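import Literature.Geometry.Symplectic.StandardEnd
import HarnessLib

/-!
# Taming witnesses: the relative Sullivan structure current of an almost complex `4`-manifold end

Trunk `Literature/Geometry/Symplectic` (next to `StandardEnd.lean`); definition request
`defn-TamingWitness` of route `SmoothPoincare4/SullivanDual` (items `stmt-SmoothPoincare4-7823`
`Target`, `7824` `WitnessCharge`, `7827` `RelativeSullivanDuality`).

For a `4`-manifold `M` charted on `ℝ⁴` (model `𝓡 4`), a point `p : M`, a radius `ε`, a field of
endomorphisms `J x : T_x(M ∖ p) → T_x(M ∖ p)` (an almost complex structure in the applications)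
and a linear functional `T` on the `2`-forms of `M ∖ p` (`Literature.Geometry.Kaehler.MForm`),
**`TamingWitness p ε J T`** is the conjunction of

* **(W1)** `T α > 0` for every smooth `2`-form `α` that TAMES `J` off the punctured chart-ball of
  radius `ε` (`α_x(v, J v) > 0` for `v ≠ 0`, `x ∉ B_ε(p)`);
* **(W2)** `T α = 0` for every smooth closed `α` vanishing on the punctured `ε`-ball;
* **(W3)** `T α ≤ 0` for every smooth closed `α` that is STANDARD on the punctured `ε`-ball, i.e.
  equals there the pull-back of the inverted standard form `ι*ω₀` through the recentred chart at
  `p` (`Literature.Geometry.Symplectic.invertedStdForm`, exactly as in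
  `IsSymplecticStandardNearPoint` of `StandardEnd.lean`),

VERBATIM the conjunction negated in those three items, so that
`NoWitness p ε J := ∀ T, ¬ TamingWitness p ε J T` restates them by `Iff.rfl`
(`noWitness_iff`; precedent `isSymplecticStandardNearPoint_iff`).

Mathematical meaning (Sullivan 1976, Thm. I.7; Harvey–Lawson 1983; for closed manifolds
Li–Zhang 2009, Thm. 3.1 of arXiv:0708.2520, "Sullivan's observation using the duality between
forms and currents, the Hahn–Banach theorem, and compactness"): a structure current for the cone
of `J`-tamed forms RELATIVE to the standard end — a non-zero functional positive on the open
convex cone of forms taming `J` off the ball, vanishing on closed forms supported off the ball,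
and non-positive on the closed extensions of the model form; by Hahn–Banach its NON-existence is
equivalent to the existence of a closed form, standard on the ball, taming `J` off it (this
equivalence is the route's item `RelativeSullivanDuality`, not asserted here).

## API

* `tamingWitness_iff`, `noWitness_iff` (`Iff.rfl` unfoldings), the projections `.pos_of_tames`,
  `.eq_zero_of_vanishes`, `.nonpos_of_standard`;
* monotonicity in the radius, in the directions that hold (`InPuncturedChartBall` grows with
  `ε`): (W1) passes to SMALLER radii (`TamingWitness.w1_anti`), (W2) and (W3) to LARGER radii
  (`w2_mono`, `w3_mono`);
* `TamingWitness.eq_zero_of_vanishes_off_ball`: if some smooth form tames `J` off the ball, a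
  witness kills every smooth form vanishing off the ball (scaling in (W1)); hence
  `not_tamingWitness_zero` (`T = 0` is never a witness once a taming form exists).

Deliberately NOT here: invariance under diffeomorphisms preserving the chart data, and the flat
`ℝ⁴` (stereographic) version of the notion — both requested as "wished API (c), (d)" and left to
the route (they need pull-back of `MForm`s along diffeomorphisms, absent from the tree).

## References

* D. Sullivan, *Cycles for the dynamical study of foliated manifolds and complex manifolds*,
  Invent. Math. 36 (1976), 225–255, Thm. I.7. [Sullivan1976]
* R. Harvey, H. B. Lawson, *An intrinsic characterization of Kähler manifolds*, Invent. Math. 74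
  (1983), 169–198. [HarveyLawson1983]
* T.-J. Li, W. Zhang, *Comparing tamed and compatible symplectic cones and cohomological
  properties of almost complex manifolds*, Comm. Anal. Geom. 17 (2009), arXiv:0708.2520, §3.1.1,
  Thm. 3.1 (structure currents/cycles of an ample cone structure; closed case). [LiZhang2009]
* M. Gromov, *Pseudo holomorphic curves in symplectic manifolds*, Invent. Math. 82 (1985), §0.3.C.
  [Gromov1985]
-/

noncomputable section

open scoped Manifold ContDiff
open TopologicalSpace Set Literature.Geometry.Kaehler

namespace Literature.Geometry.Symplectic

variable {M : Type*} [TopologicalSpace M] [ChartedSpace (EuclideanSpace ℝ (Fin 4)) M] [T1Space M]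

/-- A smooth `2`-form `α` on `M ∖ p` **tames `J` off the punctured `ε`-ball**: `α_x(v, J_x v) > 0`
for every `x` outside the punctured chart-ball of radius `ε` and every `v ≠ 0` (the hypothesis of
(W1)). [cite: Gromov1985, §0.3.C] -/
def TamesOffBall (p : M) (ε : ℝ)
    (J : ∀ x : punctured p, TangentSpace (𝓡 4) x →L[ℝ] TangentSpace (𝓡 4) x)
    (α : MForm (𝓡 4) (punctured p) ℝ 2) : Prop :=
  ∀ x : punctured p, ¬ InPuncturedChartBall p ε x → ∀ v : TangentSpace (𝓡 4) x, v ≠ 0 →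
    0 < α x ![v, J x v]

/-- A `2`-form `α` on `M ∖ p` **is standard on the punctured `ε`-ball**: there it equals the
pull-back of `ι*ω₀` through the recentred extended chart at `p` (the hypothesis of (W3); the same
clause as in `IsSymplecticStandardNearPoint`). [cite: Gromov1985, §0.3.C] -/
def IsStandardOnBall (p : M) (ε : ℝ) (α : MForm (𝓡 4) (punctured p) ℝ 2) : Prop :=
  ∀ x : punctured p, InPuncturedChartBall p ε x → ∀ v w : TangentSpace (𝓡 4) x,
    α x ![v, w] = invertedStdForm (extChartAt (𝓡 4) p x.1 - extChartAt (𝓡 4) p p)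
      (mfderiv (𝓡 4) 𝓘(ℝ, EuclideanSpace ℝ (Fin 4))
        (fun z : punctured p => extChartAt (𝓡 4) p z.1) x v)
      (mfderiv (𝓡 4) 𝓘(ℝ, EuclideanSpace ℝ (Fin 4))
        (fun z : punctured p => extChartAt (𝓡 4) p z.1) x w)

/-- **Taming witness** (relative Sullivan structure current) at radius `ε` for the endomorphism
field `J` on `M ∖ p`: a linear functional `T` on `2`-forms with
(W1) `T α > 0` for every smooth `α` taming `J` off the punctured `ε`-ball,
(W2) `T α = 0` for every smooth closed `α` vanishing on the ball, and
(W3) `T α ≤ 0` for every smooth closed `α` standard (`= ι*ω₀` through the chart) on the ball.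
Written VERBATIM as the conjunction of items `stmt-SmoothPoincare4-7823/7824/7827` (the named
predicates `TamesOffBall`, `IsStandardOnBall` unfold by `rfl`). Sullivan 1976, Thm. I.7 (structure
currents and the Hahn–Banach alternative), in the relative form used by route `SullivanDual`.
[cite: Sullivan1976, Thm. I.7] [cite: LiZhang2009, §3.1.1 and Thm. 3.1 (closed case)] -/
def TamingWitness (p : M) (ε : ℝ)
    (J : ∀ x : punctured p, TangentSpace (𝓡 4) x →L[ℝ] TangentSpace (𝓡 4) x)
    (T : MForm (𝓡 4) (punctured p) ℝ 2 →ₗ[ℝ] ℝ) : Prop :=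
  (∀ α : MForm (𝓡 4) (punctured p) ℝ 2, IsSmoothForm α →
      (∀ x : punctured p, ¬ InPuncturedChartBall p ε x → ∀ v : TangentSpace (𝓡 4) x, v ≠ 0 →
        0 < α x ![v, J x v]) → 0 < T α) ∧
  (∀ α : MForm (𝓡 4) (punctured p) ℝ 2, IsSmoothForm α → IsClosedForm α →
      (∀ x : punctured p, InPuncturedChartBall p ε x → α x = 0) → T α = 0) ∧
  (∀ α : MForm (𝓡 4) (punctured p) ℝ 2, IsSmoothForm α → IsClosedForm α →
      (∀ x : punctured p, InPuncturedChartBall p ε x → ∀ v w : TangentSpace (𝓡 4) x,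
        α x ![v, w] = invertedStdForm (extChartAt (𝓡 4) p x.1 - extChartAt (𝓡 4) p p)
          (mfderiv (𝓡 4) 𝓘(ℝ, EuclideanSpace ℝ (Fin 4))
            (fun z : punctured p => extChartAt (𝓡 4) p z.1) x v)
          (mfderiv (𝓡 4) 𝓘(ℝ, EuclideanSpace ℝ (Fin 4))
            (fun z : punctured p => extChartAt (𝓡 4) p z.1) x w)) →
      T α ≤ 0)

/-- **No taming witness at radius `ε`**: the conclusion of items `7823/7824/7827` for a fixed
`J` and `ε`. [cite: Sullivan1976, Thm. I.7] -/
def NoWitness (p : M) (ε : ℝ)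
    (J : ∀ x : punctured p, TangentSpace (𝓡 4) x →L[ℝ] TangentSpace (𝓡 4) x) : Prop :=
  ∀ T : MForm (𝓡 4) (punctured p) ℝ 2 →ₗ[ℝ] ℝ, ¬ TamingWitness p ε J T

/-! ### Unfolding lemmas -/

variable {p : M} {ε : ℝ}
  {J : ∀ x : punctured p, TangentSpace (𝓡 4) x →L[ℝ] TangentSpace (𝓡 4) x}
  {T : MForm (𝓡 4) (punctured p) ℝ 2 →ₗ[ℝ] ℝ}

/-- `TamingWitness` in terms of the named hypotheses `TamesOffBall` / `IsStandardOnBall`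
(definitional). [folklore] -/
theorem tamingWitness_iff :
    TamingWitness p ε J T ↔
      (∀ α, IsSmoothForm α → TamesOffBall p ε J α → 0 < T α) ∧
      (∀ α, IsSmoothForm α → IsClosedForm α →
        (∀ x : punctured p, InPuncturedChartBall p ε x → α x = 0) → T α = 0) ∧
      (∀ α, IsSmoothForm α → IsClosedForm α → IsStandardOnBall p ε α → T α ≤ 0) :=
  Iff.rfl

/-- `NoWitness` unfolds to the verbatim negated conjunction of items `7823/7824/7827`.
[folklore] -/
theorem noWitness_iff :
    NoWitness p ε J ↔ ∀ T : MForm (𝓡 4) (punctured p) ℝ 2 →ₗ[ℝ] ℝ,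
      ¬ ((∀ α : MForm (𝓡 4) (punctured p) ℝ 2, IsSmoothForm α →
            (∀ x : punctured p, ¬ InPuncturedChartBall p ε x → ∀ v : TangentSpace (𝓡 4) x,
              v ≠ 0 → 0 < α x ![v, J x v]) → 0 < T α) ∧
        (∀ α : MForm (𝓡 4) (punctured p) ℝ 2, IsSmoothForm α → IsClosedForm α →
            (∀ x : punctured p, InPuncturedChartBall p ε x → α x = 0) → T α = 0) ∧
        (∀ α : MForm (𝓡 4) (punctured p) ℝ 2, IsSmoothForm α → IsClosedForm α →
            (∀ x : punctured p, InPuncturedChartBall p ε x → ∀ v w : TangentSpace (𝓡 4) x,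
              α x ![v, w] = invertedStdForm (extChartAt (𝓡 4) p x.1 - extChartAt (𝓡 4) p p)
                (mfderiv (𝓡 4) 𝓘(ℝ, EuclideanSpace ℝ (Fin 4))
                  (fun z : punctured p => extChartAt (𝓡 4) p z.1) x v)
                (mfderiv (𝓡 4) 𝓘(ℝ, EuclideanSpace ℝ (Fin 4))
                  (fun z : punctured p => extChartAt (𝓡 4) p z.1) x w)) →
            T α ≤ 0)) :=
  Iff.rfl

/-- (W1): a witness is positive on smooth forms taming `J` off the ball. [folklore] -/
theorem TamingWitness.pos_of_tames (h : TamingWitness p ε J T) {α : MForm (𝓡 4) (punctured p) ℝ 2}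
    (hα : IsSmoothForm α) (ht : TamesOffBall p ε J α) : 0 < T α :=
  h.1 α hα ht

/-- (W2): a witness kills smooth closed forms vanishing on the ball. [folklore] -/
theorem TamingWitness.eq_zero_of_vanishes (h : TamingWitness p ε J T)
    {α : MForm (𝓡 4) (punctured p) ℝ 2} (hα : IsSmoothForm α) (hc : IsClosedForm α)
    (h0 : ∀ x : punctured p, InPuncturedChartBall p ε x → α x = 0) : T α = 0 :=
  h.2.1 α hα hc h0

/-- (W3): a witness is non-positive on smooth closed forms standard on the ball. [folklore] -/
theorem TamingWitness.nonpos_of_standard (h : TamingWitness p ε J T)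
    {α : MForm (𝓡 4) (punctured p) ℝ 2} (hα : IsSmoothForm α) (hc : IsClosedForm α)
    (hs : IsStandardOnBall p ε α) : T α ≤ 0 :=
  h.2.2 α hα hc hs

/-! ### Monotonicity in the radius -/

/-- The punctured chart-ball grows with the radius. [folklore] -/
theorem InPuncturedChartBall.mono {ε ε' : ℝ} (hle : ε ≤ ε') {x : punctured p}
    (hx : InPuncturedChartBall p ε x) : InPuncturedChartBall p ε' x :=
  ⟨hx.1, Metric.ball_subset_ball hle hx.2⟩

/-- Taming off a smaller ball implies taming off a larger one. [folklore] -/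
theorem TamesOffBall.mono {ε ε' : ℝ} (hle : ε ≤ ε') {α : MForm (𝓡 4) (punctured p) ℝ 2}
    (h : TamesOffBall p ε J α) : TamesOffBall p ε' J α :=
  fun x hx v hv => h x (fun hx' => hx (hx'.mono hle)) v hv

/-- Standard on a larger ball implies standard on a smaller one. [folklore] -/
theorem IsStandardOnBall.anti {ε ε' : ℝ} (hle : ε ≤ ε') {α : MForm (𝓡 4) (punctured p) ℝ 2}
    (h : IsStandardOnBall p ε' α) : IsStandardOnBall p ε α :=
  fun x hx v w => h x (hx.mono hle) v w

/-- (W1) passes to SMALLER radii: forms taming `J` off the `ε`-ball tame it off the `ε'`-ball,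
`ε ≤ ε'`. [folklore] -/
theorem TamingWitness.w1_anti {ε ε' : ℝ} (hle : ε ≤ ε') (h : TamingWitness p ε' J T) :
    ∀ α, IsSmoothForm α → TamesOffBall p ε J α → 0 < T α :=
  fun _ hα ht => h.pos_of_tames hα (ht.mono hle)

/-- (W2) passes to LARGER radii: forms vanishing on the `ε'`-ball vanish on the `ε`-ball,
`ε ≤ ε'`. [folklore] -/
theorem TamingWitness.w2_mono {ε ε' : ℝ} (hle : ε ≤ ε') (h : TamingWitness p ε J T) :
    ∀ α : MForm (𝓡 4) (punctured p) ℝ 2, IsSmoothForm α → IsClosedForm α →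
      (∀ x : punctured p, InPuncturedChartBall p ε' x → α x = 0) → T α = 0 :=
  fun _ hα hc h0 => h.eq_zero_of_vanishes hα hc fun x hx => h0 x (hx.mono hle)

/-- (W3) passes to LARGER radii: forms standard on the `ε'`-ball are standard on the `ε`-ball,
`ε ≤ ε'`. [folklore] -/
theorem TamingWitness.w3_mono {ε ε' : ℝ} (hle : ε ≤ ε') (h : TamingWitness p ε J T) :
    ∀ α, IsSmoothForm α → IsClosedForm α → IsStandardOnBall p ε' α → T α ≤ 0 :=
  fun _ hα hc hs => h.nonpos_of_standard hα hc (hs.anti hle)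

/-! ### Consequences of (W1) by scaling -/

/-- If some smooth form `β` tames `J` off the ball, a witness KILLS every smooth form `α` that
vanishes off the ball: `β + t•α` tames `J` off the ball for every real `t`, so `T β + t·T α > 0`
for all `t`, forcing `T α = 0`. [folklore] -/
theorem TamingWitness.eq_zero_of_vanishes_off_ball (h : TamingWitness p ε J T)
    {β : MForm (𝓡 4) (punctured p) ℝ 2} (hβ : IsSmoothForm β) (hβt : TamesOffBall p ε J β)
    {α : MForm (𝓡 4) (punctured p) ℝ 2} (hα : IsSmoothForm α)
    (hα0 : ∀ x : punctured p, ¬ InPuncturedChartBall p ε x → α x = 0) : T α = 0 := by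
  by_contra hne
  set t : ℝ := (-(T β) - 1) / T α with ht
  have htame : TamesOffBall p ε J (β + t • α) := by
    intro x hx v hv
    have := hβt x hx v hv
    simpa [hα0 x hx] using this
  have hpos := h.pos_of_tames (hβ.add (hα.smul t)) htame
  rw [map_add, map_smul, smul_eq_mul, ht, div_mul_cancel₀ _ hne] at hpos
  linarith

/-- In particular `T = 0` is not a witness as soon as some smooth form tames `J` off the ball
((W1) would give `0 < 0`). [folklore] -/
theorem not_tamingWitness_zero {β : MForm (𝓡 4) (punctured p) ℝ 2} (hβ : IsSmoothForm β)
    (hβt : TamesOffBall p ε J β) : ¬ TamingWitness p ε J 0 :=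
  fun h => (lt_irrefl (0 : ℝ)) (by simpa using h.pos_of_tames hβ hβt)

end Literature.Geometry.Symplectic
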